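import Summits.ABC.StewartYu.Y07OddExplicit
import Summits.ABC.StewartYu.Y07TwoExplicit
import HarnessLib

/-!
# First rungs (T3 / BC5 witnesses) for the cruxes `PadicCoreOddRat` and `PadicCoreTwoRat` of route YuMatveevShapeRat (rung A1.L)

Each theorem below is the corresponding crux text VERBATIM with ONE extra hypothesis (a Kummer condition on
`θ`) and an explicit constant: a PROVED special case of the crux (the Kummer regime), obtained from the landed
A1.M3 engines `Summit.ABC.StewartYu.YuOhSeven.coreOdd_two_pow_100` (odd `p`, signed 2-Kummer condition,
`c = 2 ^ 100`) and `Summit.ABC.StewartYu.YuOhSeven.coreTwo_two_pow_110` (`p = 2`, 3-Kummer condition,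
`c = 2 ^ 110`). The target `Dioph.approximationBound_rat` (A1.L) is not a tree theorem in any regime, so these
rungs lie outside its known regime and exercise the route's lever (the Gen-3 frame + Matveev-type induction).

Proofs only; no new definitions, no named-fact hypotheses.
-/

open Finset

namespace Summit.ABC.StewartYu

/-- First rung of crux `PadicCoreOddRat` (route YuMatveevShapeRat): the crux text verbatim for odd primes `p`,
with the extra signed 2-Kummer hypothesis on `θ` (third displayed hypothesis) and the explicit constant
`c = 2 ^ 100`; a direct consequence of `YuOhSeven.coreOdd_two_pow_100`. -/
theorem padicCoreOddRat_kummerRung : ∃ c : ℝ, ∀ (p : ℕ), p.Prime → p ≠ 2 →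
    ∀ (r : ℕ) (θ : Fin r → ℚ) (m : Fin r → ℤ) (A : Fin r → ℝ) (Amax W : ℝ),
      (∀ i, θ i ≠ 0 ∧ padicValRat p (θ i) = 0) →
      (∀ μ : Fin r → ℤ, ∏ i, θ i ^ μ i = 1 → μ = 0) →
      (∀ κ : Fin r → ℤ, (∃ γ : ℚ, ∏ i, θ i ^ κ i = γ ^ 2 ∨ ∏ i, θ i ^ κ i = -γ ^ 2) →
        ∀ i, (2 : ℤ) ∣ κ i) →
      (∀ i, Height.logHeight₁ (θ i) ≤ A i) → (∀ i, 1 ≤ A i) → (∀ i, A i ≤ Amax) →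
      m ≠ 0 → (∀ i, Real.log (max 3 (|m i| : ℝ)) ≤ W) → 1 ≤ W →
      (padicValRat p (∏ i, θ i ^ m i - 1) : ℝ) * Real.log p ≤
        c ^ r * ((p : ℝ) / Real.log p) * (∏ i, A i) * (W + Real.log p + Real.log (2 * Amax)) := by
  refine ⟨(2 : ℝ) ^ 100, fun p hp hp2 r θ m A Amax W hu hind hK hA hA1 hAm hm hW hW1 => ?_⟩
  haveI : Fact p.Prime := ⟨hp⟩
  exact YuOhSeven.coreOdd_two_pow_100 p hp2 r θ m A Amax W hu hind hK hA hA1 hAm hm hW hW1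

/-- First rung of crux `PadicCoreTwoRat` (route YuMatveevShapeRat): the crux text verbatim at `p = 2`, with the
extra 3-Kummer hypothesis on `θ` (third displayed hypothesis) and the explicit constant `c = 2 ^ 110`; a direct
consequence of `YuOhSeven.coreTwo_two_pow_110`. -/
theorem padicCoreTwoRat_kummerRung : ∃ c : ℝ, ∀ (r : ℕ) (θ : Fin r → ℚ) (m : Fin r → ℤ) (A : Fin r → ℝ)
    (Amax W : ℝ),
    (∀ i, 3 ≤ padicValRat 2 (θ i - 1)) →
    (∀ μ : Fin r → ℤ, ∏ i, θ i ^ μ i = 1 → μ = 0) →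
    (∀ κ : Fin r → ℤ, (∃ γ : ℚ, ∏ i, θ i ^ κ i = γ ^ 3) → ∀ i, (3 : ℤ) ∣ κ i) →
    (∀ i, Height.logHeight₁ (θ i) ≤ A i) → (∀ i, 1 ≤ A i) → (∀ i, A i ≤ Amax) →
    m ≠ 0 → (∀ i, Real.log (max 3 (|m i| : ℝ)) ≤ W) → 1 ≤ W →
    (padicValRat 2 (∏ i, θ i ^ m i - 1) : ℝ) ≤ c ^ r * (∏ i, A i) * (W + Real.log (2 * Amax)) := by
  refine ⟨(2 : ℝ) ^ 110, fun r θ m A Amax W hu hind hK hA hA1 hAm hm hW hW1 => ?_⟩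
  have h := YuOhSeven.coreTwo_two_pow_110 r θ m A Amax W hu hind hK hA hA1 hAm hm hW hW1
  have hc : ((2 : ℝ) ^ 110) ^ r = (2 : ℝ) ^ (110 * r) := by rw [← pow_mul]
  rw [hc]; exact h

end Summit.ABC.StewartYu
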